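import Summits.BirchSwinnertonDyer.Rank1Residual.X12.O11.RouteUPsiD11
import Summits.BirchSwinnertonDyer.Rank1Residual.X12.O11.RouteUInvMulOmega
import Summits.BirchSwinnertonDyer.Rank1Residual.X12.O11.RouteUBernoulliCertificate
import Mathlib.NumberTheory.LegendreSymbol.JacobiSymbol
import Mathlib.NumberTheory.LegendreSymbol.QuadraticChar.Basic
import HarnessLib

/-!
# ROUTE U, generic prime member `D = −q` — the ψ-layer `ψ_q = χ_{−q}·ω²` at level `7q` and the
# Bernoulli character `θ₂ = χ_q↑·κ_r↑·ω↑` at level `7qr`, for ANY odd prime `q ≠ 7` and ANY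
# odd `r` coprime to `7q` (the generic-`q` refactor of `RouteUPsiD11`, planner ORDER v4.9/v5.0 (4))

bsd-cm cell, ROUTE U (Theorem U: BSD(49a1^{(D)}, 7) ⇒ full BSD on `𝒞₇`). `RouteUPsiD11` did the
member `q = 11`, `r = 19` with numerals; this file redoes it for a VARIABLE prime `q` (the twisting
prime, `D = −q`) and a VARIABLE odd level `r` (the Heegner field `K'' = ℚ(√−r)`), so that every
prime member of `𝒞₇` is ONE instance file away (two `decide` certificates). Given `ω` mod `7`
Teichmüller, `χ` mod `q` with Legendre values `(·/q)`, `κ` mod `r` with Jacobi values `J(· | r)`: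

* `legendreChar_ne_one` — `χ ≠ 1` (an odd prime has a non-residue); `jacobiChar_ne_one_of_prime`;
* `psiPrime_apply` — `ψ(j) = (j/q)·ω(j)²` at level `7q`; `psiPrime_isPrimitive` (conductor `7q`);
  `psiPrime_apply_seven_ne_one`; `psiPrime_odd` (for `q ≡ 3 (mod 4)`: `(−1/q) = −1`);
* `psiPrime_traceIdentity` — `ψ(ℓ) + ψ⁻¹(ℓ)ω(ℓ) = (ℓ/q)(ω(ℓ)² + ω(ℓ)⁵)` for `7 ∤ ℓ`, `q ∤ ℓ` (the
  input of `RouteUTraceForm.hss_twist_cm7`);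
* `psiPrime_inv_apply` (`ψ⁻¹(j) = (j/q)ω(j)⁴`), `psiPrime_inv_isPrimitive`,
  `bernoulliCharOne_psiPrime` (`= (ψ⁻¹)↑`);
* `thetaTwo_apply` (`θ₂(j) = (j/q)·J(j|r)·ω(j)`), `thetaTwo_isPrimitive` (conductor `7qr` when
  `κ` is primitive), `bernoulliCharTwo_psiPrime` (`= θ₂↑`);
* hypotheses (1)/(3) of Kriz–Li Thm. 1.20: `psiPrime_apply_natCast_ne_one_of_dvd`,
  `primVal_invMulOmega_psiPrime_ne_one_of_dvd` (values at `7` and at `q` are `0 ≠ 1`).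

THEOREMS ONLY; no definitions, no named facts. References: [KrizLi2019] Thm. 1.20, §1.5, §2;
[Washington1997] Ch. 3, §5.1.
-/

noncomputable section

open scoped Classical
open DirichletCharacter Literature.NumberTheory.EllipticCurves.KrizLi2019 Literature.NumberTheory.LFunctions

namespace Summit.BirchSwinnertonDyer.Rank1Residual.X12.O11.RouteU

/-! ## §0 `bernoulliOnePrim` is level-independent (moved here from the `D = −11` instance file) -/

/-- **`bernoulliOnePrim` is invariant under `changeLevel`** (it is `B_{1,θ}` of the primitive
character `θ` inducing the argument; a lift of `χ` is a lift of `θ`).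
[cite: KrizLi2019, §2 (p. 11, conventions on primitive characters)] -/
theorem bernoulliOnePrim_changeLevel {p : ℕ} [Fact p.Prime] {m n : ℕ} [NeZero m] [NeZero n]
    (h : m ∣ n) (χ : DirichletCharacter ℚ_[p] m) :
    bernoulliOnePrim (changeLevel h χ) = bernoulliOnePrim χ := by
  haveI : NeZero χ.conductor := ⟨conductor_ne_zero χ⟩
  have e1 : changeLevel h χ =
      changeLevel ((conductor_dvd_level χ).trans h) χ.primitiveCharacter := by
    conv_lhs => rw [← changeLevel_primitiveCharacter χ]
    rw [← changeLevel_trans]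
  have e2 : bernoulliOnePrim χ = generalizedBernoulli 1 χ.primitiveCharacter := by
    conv_lhs => rw [← changeLevel_primitiveCharacter χ]
    exact bernoulliOnePrim_changeLevel_eq _ (primitiveCharacter_isPrimitive χ) _
  rw [e1, bernoulliOnePrim_changeLevel_eq _ (primitiveCharacter_isPrimitive χ), e2]

/-! ## §0b Certificates over `Finset.range` (so that long sums can be split into `decide`-sized blocks) -/

/-- A sum over `ZMod n` of a function of `val` is the sum over `range n`. [folklore] -/
theorem sum_univ_zmod_eq_sum_range {n : ℕ} [NeZero n] (f : ℕ → ℤ) :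
    ∑ j : ZMod n, f j.val = ∑ q ∈ Finset.range n, f q := by
  refine Finset.sum_nbij' (fun j => j.val) (fun q => (q : ZMod n)) (fun j _ => ?_) (fun q hq => ?_)
    (fun j _ => ?_) (fun q hq => ?_) (fun j _ => ?_)
  · exact Finset.mem_range.2 (ZMod.val_lt j)
  · exact Finset.mem_univ _
  · exact ZMod.natCast_zmod_val j
  · exact ZMod.val_cast_of_lt (Finset.mem_range.1 hq)
  · rfl

/-- **The mod-`p²` certificate with the sum over `Finset.range n`** (same content as
`norm_generalizedBernoulli_one_eq_one_of_cert`; the range form lets a long sum be evaluated block by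
block with `Finset.sum_Ico_consecutive`). [cite: KrizLi2019, §1.5 display (1) (p. 7)]
[cite: Washington1997, §5.1 and Thm. 4.2] -/
theorem norm_generalizedBernoulli_one_eq_one_of_cert_range {p : ℕ} [Fact p.Prime] {n : ℕ} [NeZero n]
    (χ : DirichletCharacter ℚ_[p] n) (hχ : χ ≠ 1) (hn : padicValNat p n = 1) (c : ℕ → ℤ) (e : ℕ)
    (happrox : ∀ j : ZMod n, ‖χ j - (c j.val : ℚ_[p]) * (j.val : ℚ_[p]) ^ e‖ ≤ (p : ℝ) ^ (-2 : ℤ))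
    (S : ℤ) (hS : ∑ q ∈ Finset.range n, c q * (q : ℤ) ^ (e + 1) = S)
    (h1 : (p : ℤ) ∣ S) (h2 : ¬ (p : ℤ) ^ 2 ∣ S) : ‖generalizedBernoulli 1 χ‖ = 1 := by
  have hsum : ∑ j : ZMod n, c j.val * (j.val : ℤ) ^ (e + 1) = S := by
    rw [← hS]; exact sum_univ_zmod_eq_sum_range (fun q => c q * (q : ℤ) ^ (e + 1))
  refine norm_generalizedBernoulli_one_eq_one_of_cert χ hχ hn (fun j => c j.val) e happrox ?_ ?_
  · rw [hsum]; exact h1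
  · rw [hsum]; exact h2

/-! ## §1 Legendre / Jacobi valued characters are non-trivial -/

/-- A character mod an odd prime `q` with Legendre values is non-trivial (there is a quadratic
non-residue mod `q`). [folklore] -/
theorem legendreChar_ne_one {q : ℕ} [Fact q.Prime] (hq2 : q ≠ 2) (χ : DirichletCharacter ℚ_[7] q)
    (hχ : ∀ a : ℕ, χ (a : ZMod q) = (legendreSym q (a : ℤ) : ℚ_[7])) : χ ≠ 1 := by
  intro h
  have hF : ringChar (ZMod q) ≠ 2 := by rw [ZMod.ringChar_zmod_n]; exact hq2
  obtain ⟨a, ha⟩ := FiniteField.exists_nonsquare hF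
  have ha0 : a ≠ 0 := fun h0 => ha (h0 ▸ IsSquare.zero)
  have hu : IsUnit a := Ne.isUnit ha0
  have hval : χ a = 1 := by rw [h, MulChar.one_apply hu]
  have hleg : legendreSym q (a.val : ℤ) = -1 := by
    rw [legendreSym.eq_neg_one_iff]
    simpa [ZMod.natCast_zmod_val] using ha
  have := hχ a.val
  rw [ZMod.natCast_zmod_val, hval, hleg] at this
  norm_num at this

/-! ## §2 `ψ_q = χ↑·(ω²)↑` at level `7q` -/

section Psi

variable {q : ℕ} [hq : Fact q.Prime] (ω : DirichletCharacter ℚ_[7] 7) (χ : DirichletCharacter ℚ_[7] q)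

/-- `7q ≠ 0`. [folklore] -/
@[instance] theorem neZero_seven_mul : NeZero (7 * q) := ⟨Nat.mul_ne_zero (by norm_num) hq.out.ne_zero⟩

omit hq in
/-- The residue of `j mod 7q` mod `7` is `j mod 7`. [folklore] -/
theorem natCast_val_zmod_seven_mul (ℓ : ℕ) :
    ((((ℓ : ZMod (7 * q))).val : ℕ) : ZMod 7) = (ℓ : ZMod 7) := by
  rw [ZMod.val_natCast, ZMod.natCast_eq_natCast_iff', Nat.mod_mod_of_dvd ℓ (dvd_mul_right 7 q)]

/-- `((j mod 7q)/q) = (j/q)`. [folklore] -/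
theorem legendreSym_val_zmod_seven_mul (ℓ : ℕ) :
    legendreSym q ((((ℓ : ZMod (7 * q))).val : ℕ) : ℤ) = legendreSym q (ℓ : ℤ) := by
  rw [ZMod.val_natCast, legendreSym.mod q (ℓ : ℤ), legendreSym.mod q (((ℓ % (7 * q) : ℕ) : ℤ))]
  congr 1
  push_cast
  exact Int.emod_emod_of_dvd _ (by exact_mod_cast dvd_mul_left q 7)

/-- **Values of `ψ_q = χ↑·(ω²)↑` at level `7q`: `ψ(j) = (j/q)·ω(j)²`** (units: `changeLevel`;
non-units: both sides vanish). [cite: KrizLi2019, §2 (p. 11, conventions on characters)] -/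
theorem psiPrime_apply
    (hχ : ∀ a : ℕ, χ (a : ZMod q) = (legendreSym q (a : ℤ) : ℚ_[7])) (j : ZMod (7 * q)) :
    (changeLevel (dvd_mul_left q 7) χ * changeLevel (dvd_mul_right 7 q) (ω ^ 2) :
      DirichletCharacter ℚ_[7] (7 * q)) j =
      (legendreSym q (j.val : ℤ) : ℚ_[7]) * ω (j.val : ZMod 7) ^ 2 := by
  have hj : ((j.val : ℤ) : ZMod (7 * q)) = j := by rw [Int.cast_natCast, ZMod.natCast_zmod_val]
  by_cases hu : IsCoprime (j.val : ℤ) ((7 * q : ℕ) : ℤ)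
  · conv_lhs => rw [← hj]
    rw [MulChar.mul_apply, changeLevel_eq_cast_of_dvd' _ _ hu, changeLevel_eq_cast_of_dvd' _ _ hu,
      MulChar.pow_apply' _ two_ne_zero, Int.cast_natCast, Int.cast_natCast, hχ]
  · have hnu : ¬ IsUnit j := by
      rw [← hj, ZMod.coe_int_isUnit_iff_isCoprime]; exact fun h => hu (by simpa [isCoprime_comm] using h)
    rw [MulChar.map_nonunit _ hnu]
    have h77 : ¬ (j.val).Coprime (7 * q) := fun h => hu (Nat.isCoprime_iff_coprime.mpr h)
    rw [Nat.coprime_mul_iff_right, not_and_or] at h77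
    rcases h77 with h7 | h11
    · have hd : 7 ∣ j.val := by
        rwa [Nat.coprime_comm, Nat.Prime.coprime_iff_not_dvd (by norm_num), not_not] at h7
      have h0 : (j.val : ZMod 7) = 0 := (ZMod.natCast_eq_zero_iff _ _).mpr hd
      rw [h0, MulChar.map_zero, zero_pow two_ne_zero, mul_zero]
    · have hd : q ∣ j.val := by
        rwa [Nat.coprime_comm, Nat.Prime.coprime_iff_not_dvd hq.out, not_not] at h11
      have h0 : legendreSym q (j.val : ℤ) = 0 :=
        (legendreSym.eq_zero_iff q _).mpr (by
          rw [Int.cast_natCast]; exact (ZMod.natCast_eq_zero_iff _ _).mpr hd)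
      rw [h0, Int.cast_zero, zero_mul]

/-- **`ψ_q` is primitive of conductor `7q`** (`q ≠ 2, 7`; conductors `q` and `7` coprime).
[cite: KrizLi2019, Thm. 1.20 (p. 7)] [cite: Washington1997, Ch. 3] -/
theorem psiPrime_isPrimitive (hq7 : q ≠ 7) (hq2 : q ≠ 2) (hω : IsTeichmullerCharacter ω)
    (hχ : ∀ a : ℕ, χ (a : ZMod q) = (legendreSym q (a : ℤ) : ℚ_[7])) :
    (changeLevel (dvd_mul_left q 7) χ * changeLevel (dvd_mul_right 7 q) (ω ^ 2) :
      DirichletCharacter ℚ_[7] (7 * q)).IsPrimitive := by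
  have hcq := conductor_eq_of_prime_of_ne_one χ (legendreChar_ne_one hq2 χ hχ)
  have hc7 := conductor_eq_of_prime_of_ne_one (ω ^ 2) (teichmuller_sq_ne_one ω hω)
  have hcop : q.Coprime 7 := (Nat.coprime_primes hq.out (by norm_num)).mpr hq7
  rw [isPrimitive_def, conductor_changeLevel_mul_changeLevel _ _ χ (ω ^ 2) (by rw [hcq, hc7]; exact hcop),
    hcq, hc7, mul_comm]

/-- **(1a)/(3a) for `ψ_q`: `ψ(a) ≠ 1` whenever `7 ∣ a` or `q ∣ a`** (the value is `0`).
[cite: KrizLi2019, Thm. 1.20 (1), (3) (p. 7)] -/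
theorem psiPrime_apply_natCast_ne_one_of_dvd (ψ : DirichletCharacter ℚ_[7] (7 * q)) {a : ℕ}
    (ha : 7 ∣ a ∨ q ∣ a) : ψ ((a : ℕ) : ZMod (7 * q)) ≠ 1 := by
  apply apply_natCast_ne_one_of_not_coprime ψ a
  intro hc
  rcases ha with h | h
  · exact absurd (Nat.Coprime.coprime_dvd_left h (Nat.Coprime.coprime_dvd_right (dvd_mul_right 7 q) hc))
      (by norm_num)
  · have := Nat.Coprime.coprime_dvd_left h (Nat.Coprime.coprime_dvd_right (dvd_mul_left q 7) hc)
    exact hq.out.one_lt.ne' ((Nat.coprime_self q).mp this)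

/-- **(1b)/(3b) for `ψ_q`: `(ψ⁻¹ω)(a) ≠ 1` (primitive value) whenever `q ∣ a` or `7 ∣ a`.**
[cite: KrizLi2019, Thm. 1.20 (1), (3) (p. 7)] -/
theorem primVal_invMulOmega_psiPrime_ne_one_of_dvd (hq7 : q ≠ 7) (hq2 : q ≠ 2)
    (hω : IsTeichmullerCharacter ω) (hχ : ∀ a : ℕ, χ (a : ZMod q) = (legendreSym q (a : ℤ) : ℚ_[7]))
    {a : ℕ} (ha : q ∣ a ∨ 7 ∣ a) :
    primVal (invMulOmega (changeLevel (dvd_mul_left q 7) χ *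
      changeLevel (dvd_mul_right 7 q) (ω ^ 2)) ω) a ≠ 1 :=
  primVal_invMulOmega_ne_one _ _ hq7 χ (legendreChar_ne_one hq2 χ hχ) ω
    (ne_one_of_isTeichmullerCharacter (by norm_num) hω) ha

/-- **`ψ_q` is odd when `q ≡ 3 (mod 4)`**: `ψ(−1) = (−1/q)·ω(−1)² = −1`.
[cite: KrizLi2019, §1.5 (p. 7, ψ₀ = ψε_K for ψ odd)] -/
theorem psiPrime_odd (hq4 : q % 4 = 3)
    (hχ : ∀ a : ℕ, χ (a : ZMod q) = (legendreSym q (a : ℤ) : ℚ_[7])) :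
    (changeLevel (dvd_mul_left q 7) χ * changeLevel (dvd_mul_right 7 q) (ω ^ 2) :
      DirichletCharacter ℚ_[7] (7 * q)).Odd := by
  have hq2 : q ≠ 2 := by rintro rfl; norm_num at hq4
  have h1lt : 1 < 7 * q := by have := hq.out.two_le; omega
  have hneg : (-1 : ZMod (7 * q)) = ((7 * q - 1 : ℕ) : ZMod (7 * q)) := by
    rw [Nat.cast_sub (by omega), Nat.cast_one, ZMod.natCast_self, zero_sub]
  rw [DirichletCharacter.Odd, hneg, psiPrime_apply ω χ hχ]
  have hv : (((7 * q - 1 : ℕ) : ZMod (7 * q))).val = 7 * q - 1 := by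
    rw [ZMod.val_natCast, Nat.mod_eq_of_lt (by omega)]
  rw [hv]
  -- `(7q − 1 / q) = (−1/q) = −1`
  have hL : legendreSym q ((7 * q - 1 : ℕ) : ℤ) = -1 := by
    have e : ((7 * q - 1 : ℕ) : ℤ) = -1 + q * 7 := by push_cast [Nat.cast_sub (by omega : 1 ≤ 7 * q)]; ring
    rw [e, legendreSym.mod, Int.add_mul_emod_self_left, ← legendreSym.mod,
      legendreSym.at_neg_one hq2, ZMod.χ₄_nat_three_mod_four hq4]
  -- `ω(7q − 1)² = ω(−1)² = 1`
  have h6 : ((7 * q - 1 : ℕ) : ZMod 7) = -1 := by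
    rw [Nat.cast_sub (by omega), Nat.cast_mul, Nat.cast_one, ZMod.natCast_self, zero_mul, zero_sub]
  rw [hL, h6, sq, ← map_mul, neg_mul_neg, one_mul, map_one]
  norm_num

/-- **The `hss` value identity for `ψ_q`: `ψ(ℓ) + ψ⁻¹(ℓ)ω(ℓ) = (ℓ/q)·(ω(ℓ)² + ω(ℓ)⁵)` for
`7 ∤ ℓ`, `q ∤ ℓ`** — the hypothesis `hψ` of `RouteUTraceForm.hss_twist_cm7`.
[cite: KrizLi2019, Thm. 1.20 and §2 (trace form a_ℓ ≡ ψ(ℓ) + ψ⁻¹ω(ℓ))] -/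
theorem psiPrime_traceIdentity
    (hχ : ∀ a : ℕ, χ (a : ZMod q) = (legendreSym q (a : ℤ) : ℚ_[7])) (ℓ : ℕ) (h7 : ¬ 7 ∣ ℓ)
    (hqℓ : ¬ q ∣ ℓ) :
    (changeLevel (dvd_mul_left q 7) χ * changeLevel (dvd_mul_right 7 q) (ω ^ 2) :
        DirichletCharacter ℚ_[7] (7 * q)) (ℓ : ZMod (7 * q)) +
      (changeLevel (dvd_mul_left q 7) χ * changeLevel (dvd_mul_right 7 q) (ω ^ 2) :
        DirichletCharacter ℚ_[7] (7 * q))⁻¹ (ℓ : ZMod (7 * q)) * ω (ℓ : ZMod 7) =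
      (legendreSym q (ℓ : ℤ) : ℚ_[7]) * (ω (ℓ : ZMod 7) ^ 2 + ω (ℓ : ZMod 7) ^ 5) := by
  set ψ : DirichletCharacter ℚ_[7] (7 * q) :=
    changeLevel (dvd_mul_left q 7) χ * changeLevel (dvd_mul_right 7 q) (ω ^ 2) with hψdef
  have hψℓ : ψ (ℓ : ZMod (7 * q)) = (legendreSym q (ℓ : ℤ) : ℚ_[7]) * ω (ℓ : ZMod 7) ^ 2 := by
    rw [hψdef, psiPrime_apply ω χ hχ, natCast_val_zmod_seven_mul, legendreSym_val_zmod_seven_mul]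
  have hL2 : ((legendreSym q (ℓ : ℤ) : ℚ_[7])) ^ 2 = 1 := by
    have h0 : ((ℓ : ℤ) : ZMod q) ≠ 0 := by
      rw [Int.cast_natCast, Ne, ZMod.natCast_eq_zero_iff]; exact hqℓ
    rcases legendreSym.eq_one_or_neg_one q h0 with h | h <;> rw [h] <;> norm_num
  have hω6 : ω (ℓ : ZMod 7) ^ 6 = 1 := by
    have := apply_pow_sub_one_eq_one ω (ℓ : ℤ) (by exact_mod_cast h7)
    rwa [Int.cast_natCast] at this
  have hinv : ψ⁻¹ (ℓ : ZMod (7 * q)) = (legendreSym q (ℓ : ℤ) : ℚ_[7]) * ω (ℓ : ZMod 7) ^ 4 := by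
    rw [MulChar.inv_apply_eq_inv', hψℓ]
    apply inv_eq_of_mul_eq_one_right
    linear_combination (ω (ℓ : ZMod 7) ^ 6) * hL2 + hω6
  rw [hψℓ, hinv]
  ring

/-- **Values of `ψ_q⁻¹`: `ψ⁻¹(j) = (j/q)·ω(j)⁴`** (the value hypothesis of the `θ₁`-certificate).
[cite: KrizLi2019, Thm. 1.20 (p. 8)] -/
theorem psiPrime_inv_apply
    (hχ : ∀ a : ℕ, χ (a : ZMod q) = (legendreSym q (a : ℤ) : ℚ_[7])) (j : ZMod (7 * q)) :
    (changeLevel (dvd_mul_left q 7) χ * changeLevel (dvd_mul_right 7 q) (ω ^ 2) :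
        DirichletCharacter ℚ_[7] (7 * q))⁻¹ j =
      (legendreSym q (j.val : ℤ) : ℚ_[7]) * ω (j.val : ZMod 7) ^ 4 := by
  rw [MulChar.inv_apply_eq_inv', psiPrime_apply ω χ hχ]
  by_cases h7 : 7 ∣ j.val
  · have h0 : (j.val : ZMod 7) = 0 := (ZMod.natCast_eq_zero_iff _ _).mpr h7
    rw [h0, MulChar.map_zero, zero_pow two_ne_zero, zero_pow (by norm_num), mul_zero, inv_zero]
  by_cases hqj : q ∣ j.val
  · have h0 : legendreSym q (j.val : ℤ) = 0 :=
      (legendreSym.eq_zero_iff q _).mpr (by rw [Int.cast_natCast]; exact (ZMod.natCast_eq_zero_iff _ _).mpr hqj)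
    rw [h0, Int.cast_zero, zero_mul, zero_mul, inv_zero]
  have hL2 : ((legendreSym q (j.val : ℤ) : ℚ_[7])) ^ 2 = 1 := by
    have h0 : ((j.val : ℤ) : ZMod q) ≠ 0 := by
      rw [Int.cast_natCast, Ne, ZMod.natCast_eq_zero_iff]; exact hqj
    rcases legendreSym.eq_one_or_neg_one q h0 with h | h <;> rw [h] <;> norm_num
  have hω6 : ω (j.val : ZMod 7) ^ 6 = 1 := by
    have := apply_pow_sub_one_eq_one ω (j.val : ℤ) (by exact_mod_cast h7)
    rwa [Int.cast_natCast] at this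
  apply inv_eq_of_mul_eq_one_right
  linear_combination (ω (j.val : ZMod 7) ^ 6) * hL2 + hω6

/-- `ψ_q⁻¹` is primitive of level `7q`. [cite: KrizLi2019, Thm. 1.20 (p. 8)] -/
theorem psiPrime_inv_isPrimitive (hq7 : q ≠ 7) (hq2 : q ≠ 2) (hω : IsTeichmullerCharacter ω)
    (hχ : ∀ a : ℕ, χ (a : ZMod q) = (legendreSym q (a : ℤ) : ℚ_[7])) :
    (changeLevel (dvd_mul_left q 7) χ * changeLevel (dvd_mul_right 7 q) (ω ^ 2) :
        DirichletCharacter ℚ_[7] (7 * q))⁻¹.IsPrimitive := by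
  rw [isPrimitive_def, conductor_inv]
  exact psiPrime_isPrimitive ω χ hq7 hq2 hω hχ

/-! ## §3 The two Bernoulli characters of Thm. 1.20 at level `7q·r` -/

variable {r : ℕ} [hr : NeZero r] (κ : DirichletCharacter ℚ_[7] r)

/-- `7qr ≠ 0`. [folklore] -/
@[instance] theorem neZero_seven_mul_mul : NeZero (7 * q * r) := ⟨Nat.mul_ne_zero (NeZero.ne _) hr.out⟩

omit hr in
/-- **`bernoulliCharOne ψ_q κ = (ψ_q⁻¹)↑`** at level `7q·r` for `q ≡ 3 (mod 4)` (`ψ_q` odd, so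
`ψ₀ = ψκ` and `ψ₀⁻¹κ = ψ⁻¹`). [cite: KrizLi2019, Thm. 1.20 (p. 8) and §1.5 (ψ₀)] -/
theorem bernoulliCharOne_psiPrime (hq4 : q % 4 = 3)
    (hχ : ∀ a : ℕ, χ (a : ZMod q) = (legendreSym q (a : ℤ) : ℚ_[7])) :
    bernoulliCharOne
        (changeLevel (dvd_mul_left q 7) χ * changeLevel (dvd_mul_right 7 q) (ω ^ 2)) κ =
      changeLevel (dvd_mul_right (7 * q) r)
        (changeLevel (dvd_mul_left q 7) χ * changeLevel (dvd_mul_right 7 q) (ω ^ 2))⁻¹ := by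
  have hodd := psiPrime_odd ω χ hq4 hχ
  have key : ∀ a b : DirichletCharacter ℚ_[7] (7 * q * r), (a * b)⁻¹ * b = a⁻¹ := fun a b => by
    rw [mul_inv_rev, mul_comm b⁻¹ a⁻¹, inv_mul_cancel_right]
  rw [bernoulliCharOne, evenTwist, if_neg (hodd.not_even), key, map_inv]

omit hr in
/-- **`bernoulliCharTwo ψ_q κ ω = θ₂↑`** with `θ₂ := χ↑·κ↑·ω↑` at level `7q·r`
(`ψ₀ω⁻¹ = χω²κω⁻¹ = χκω`). [cite: KrizLi2019, Thm. 1.20 (p. 8) and §1.5] -/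
theorem bernoulliCharTwo_psiPrime (hq4 : q % 4 = 3)
    (hχ : ∀ a : ℕ, χ (a : ZMod q) = (legendreSym q (a : ℤ) : ℚ_[7])) :
    bernoulliCharTwo
        (changeLevel (dvd_mul_left q 7) χ * changeLevel (dvd_mul_right 7 q) (ω ^ 2)) κ ω =
      changeLevel (dvd_mul_right (7 * q * r) 7)
        (changeLevel ((dvd_mul_left q 7).trans (dvd_mul_right (7 * q) r)) χ *
          changeLevel (dvd_mul_left r (7 * q)) κ *
          changeLevel ((dvd_mul_right 7 q).trans (dvd_mul_right (7 * q) r)) ω) := by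
  have hodd := psiPrime_odd ω χ hq4 hχ
  rw [bernoulliCharTwo, evenTwist, if_neg (hodd.not_even)]
  simp only [map_mul, map_pow, map_inv, ← changeLevel_trans]
  rw [mul_inv_eq_iff_eq_mul, sq]
  ext a
  simp only [MulChar.mul_apply]
  ring

/-- **Values of `θ₂ = χ↑·κ↑·ω↑` at level `7q·r`: `θ₂(j) = (j/q)·J(j | r)·ω(j)`** when `κ` has the
Jacobi values `J(· | r)`, `r` odd and coprime to `7q` (the value hypothesis of the `θ₂`-certificate).
[cite: KrizLi2019, Thm. 1.20 (p. 8)] -/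
theorem thetaTwo_apply
    (hχ : ∀ a : ℕ, χ (a : ZMod q) = (legendreSym q (a : ℤ) : ℚ_[7]))
    (hκ : ∀ a : ℕ, κ (a : ZMod r) = (jacobiSym (a : ℤ) r : ℚ_[7])) (j : ZMod (7 * q * r)) :
    (changeLevel ((dvd_mul_left q 7).trans (dvd_mul_right (7 * q) r)) χ *
        changeLevel (dvd_mul_left r (7 * q)) κ *
        changeLevel ((dvd_mul_right 7 q).trans (dvd_mul_right (7 * q) r)) ω :
        DirichletCharacter ℚ_[7] (7 * q * r)) j =
      ((legendreSym q (j.val : ℤ) * jacobiSym (j.val : ℤ) r : ℤ) : ℚ_[7]) * ω (j.val : ZMod 7) ^ 1 := by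
  have hj : ((j.val : ℤ) : ZMod (7 * q * r)) = j := by rw [Int.cast_natCast, ZMod.natCast_zmod_val]
  by_cases hu : IsCoprime (j.val : ℤ) ((7 * q * r : ℕ) : ℤ)
  · conv_lhs => rw [← hj]
    rw [MulChar.mul_apply, MulChar.mul_apply, changeLevel_eq_cast_of_dvd' _ _ hu,
      changeLevel_eq_cast_of_dvd' _ _ hu, changeLevel_eq_cast_of_dvd' _ _ hu, Int.cast_natCast,
      Int.cast_natCast, Int.cast_natCast, hχ, hκ, pow_one, Int.cast_mul]
  · have hnu : ¬ IsUnit j := by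
      rw [← hj, ZMod.coe_int_isUnit_iff_isCoprime]; exact fun h => hu (by simpa [isCoprime_comm] using h)
    rw [MulChar.map_nonunit _ hnu]
    have h3 : ¬ (j.val).Coprime (7 * q * r) := fun h => hu (Nat.isCoprime_iff_coprime.mpr h)
    rw [Nat.coprime_mul_iff_right, Nat.coprime_mul_iff_right, not_and_or, not_and_or] at h3
    rcases h3 with (h7 | hqq) | hrr
    · have hd : 7 ∣ j.val := by
        rwa [Nat.coprime_comm, Nat.Prime.coprime_iff_not_dvd (by norm_num), not_not] at h7
      rw [(ZMod.natCast_eq_zero_iff _ _).mpr hd, MulChar.map_zero, pow_one, mul_zero]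
    · have hd : q ∣ j.val := by
        rwa [Nat.coprime_comm, Nat.Prime.coprime_iff_not_dvd hq.out, not_not] at hqq
      have h0 : legendreSym q (j.val : ℤ) = 0 :=
        (legendreSym.eq_zero_iff q _).mpr (by rw [Int.cast_natCast]; exact (ZMod.natCast_eq_zero_iff _ _).mpr hd)
      rw [h0, zero_mul, Int.cast_zero, zero_mul]
    · -- `gcd(j, r) ≠ 1` ⇒ `J(j | r) = 0`
      have hg : (j.val : ℤ).gcd r ≠ 1 := by
        intro h1; apply hrr
        have : Int.gcd (j.val : ℤ) (r : ℕ) = 1 := h1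
        rwa [Int.gcd_natCast_natCast] at this
      rw [jacobiSym.eq_zero_iff.mpr ⟨hr.out, hg⟩, mul_zero, Int.cast_zero, zero_mul]

/-- **`θ₂` is primitive of conductor `7qr`** when `κ` is primitive mod `r` (`r` coprime to `7q`,
`q ≠ 2, 7`). [cite: KrizLi2019, Thm. 1.20 (p. 8)] [cite: Washington1997, Ch. 3] -/
theorem thetaTwo_isPrimitive (hq7 : q ≠ 7) (hq2 : q ≠ 2) (hr7 : r.Coprime 7) (hrq : r.Coprime q)
    (hω : IsTeichmullerCharacter ω) (hχ : ∀ a : ℕ, χ (a : ZMod q) = (legendreSym q (a : ℤ) : ℚ_[7]))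
    (hκp : κ.IsPrimitive) :
    (changeLevel ((dvd_mul_left q 7).trans (dvd_mul_right (7 * q) r)) χ *
        changeLevel (dvd_mul_left r (7 * q)) κ *
        changeLevel ((dvd_mul_right 7 q).trans (dvd_mul_right (7 * q) r)) ω :
        DirichletCharacter ℚ_[7] (7 * q * r)).IsPrimitive := by
  have hcq := conductor_eq_of_prime_of_ne_one χ (legendreChar_ne_one hq2 χ hχ)
  have hcr : κ.conductor = r := hκp
  have hω1 : ω ≠ 1 := fun h => teichmuller_sq_ne_one ω hω (by rw [h, one_pow])
  have hc7 := conductor_eq_of_prime_of_ne_one ω hω1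
  have hcopq7 : q.Coprime 7 := (Nat.coprime_primes hq.out (by norm_num)).mpr hq7
  have h12 : (changeLevel ((dvd_mul_left q 7).trans (dvd_mul_right (7 * q) r)) χ *
      changeLevel (dvd_mul_left r (7 * q)) κ : DirichletCharacter ℚ_[7] (7 * q * r)).conductor = q * r := by
    rw [conductor_changeLevel_mul_changeLevel _ _ χ κ (by rw [hcq, hcr]; exact hrq.symm), hcq, hcr]
  rw [isPrimitive_def, conductor_mul_eq_mul_of_coprime _ _ (by
      rw [h12, conductor_changeLevel, hc7]; exact Nat.Coprime.mul_left hcopq7 hr7),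
    h12, conductor_changeLevel, hc7]
  ring

end Psi

end Summit.BirchSwinnertonDyer.Rank1Residual.X12.O11.RouteU

end
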